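import Summits.ValiantsHypothesis.ValiantsHypothesis.Theorems.BarrierLeverChowHitsPartitionMinorsRHybridRelabel

/-!
# Route BarrierLever — item `ChowHitsPartitionMinorsR` (stmt-ValiantsHypothesis-21882):
# the residual node after THEOREM H UNDER RELABELLING — «both defect masses exceed the budget for EVERY vertex relabelling»

Helper file (`--supports stmt-ValiantsHypothesis-21882`; cell valiant-natproofs, rung V4, 𝒟-side support item of route
BarrierLever; prover seat val-np-p5 gen 32; seat memo MEMO-21882-valnp5-g32.md §6–§7). Closes NO item.

`ChowNoStar.Stmt.stub_thickLowerSetsChowRLargeDefect` (p733136) asked for the thick lower-set pairs whose two defect masses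
`‖C∖R‖`, `‖R∖C‖` both exceed `h·h − 3h`. By `ChowHybrid.exists_chow_of_small_defect_relabel` (p733528) the same pair is
ALSO hit whenever, for SOME permutation `π` of the vertices, `‖π(C)∖R‖ ≤ h·h − 3h` or `‖R∖π(C)‖ ≤ h·h − 3h`. The node below
(`Stmt.stub_thickLowerSetsChowRLargeDefectRelabel`) therefore carries the two large-defect hypotheses FOR EVERY `π`; it implies
the p733136 node unconditionally (`stub_thickLowerSetsChowRLargeDefect_of_relabel`) and hence the item
(`chowHitsPartitionMinorsR_of_thickLowerSetsLargeDefectRelabel`). Its members are the pairs of simplicial complexes that stay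
far apart under every identification of their vertex sets («deep versus wide» pairs, e.g. `C = 2^B` against a skeleton).

WHAT THIS IS NOT: item 21882 is NOT proved; nothing on crux stmt-ValiantsHypothesis-14610 or on `VP` versus `VNP`.
-/

set_option linter.dupNamespace false

namespace Summit.ValiantsHypothesis.ValiantsHypothesis.Theorems.BarrierLever.ChowNoStar

open Finset MvPolynomial

open Summit.ValiantsHypothesis.ValiantsHypothesis.Theorems.BarrierLever.ChowHybrid
  (colDefectMass exists_chow_of_small_defect_relabel)

noncomputable section

variable {h r : ℕ}

/-- **NARROWED NODE (THEOREM H UNDER RELABELLING)** — `Stmt.stub_thickLowerSetsChowRNoMD` (p729761) VERBATIM with the further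
hypotheses «for every vertex permutation `π`, `h·h < h + ‖π(C)∖R‖ + 2h` and `h·h < h + ‖R∖π(C)‖ + 2h`». WEAKER than
`Stmt.stub_thickLowerSetsChowRLargeDefect`, UNCONDITIONALLY (`stub_thickLowerSetsChowRLargeDefect_of_relabel`). -/
def Stmt.stub_thickLowerSetsChowRLargeDefectRelabel : Prop :=
  ∃ h₀ : ℕ, ∀ h : ℕ, h₀ ≤ h → ∀ (r : ℕ) (v w' : Fin r → Finset (Fin h)),
    Function.Injective v → Function.Injective w' →
    IsLowerSet (Set.range v) → IsLowerSet (Set.range w') →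
    h * h < (∑ i, (v i).card) + 2 * h → h * h < (∑ j, (w' j).card) + 2 * h →
    ¬ IsXStarCertifiable v w' → ¬ IsXStarCertifiable w' v → ¬ IsBiStarCertifiable v w' →
    ¬ Summit.ValiantsHypothesis.ValiantsHypothesis.Theorems.BarrierLever.ChowStarvedDesign.IsStarvedPair v w' →
    ¬ Summit.ValiantsHypothesis.ValiantsHypothesis.Theorems.BarrierLever.ChowStarvedDesign.IsStarvedPair w' v →
    ¬ (Summit.ValiantsHypothesis.ValiantsHypothesis.Theorems.BarrierLever.ChowMD.IsMDCertifiable v w' ∧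
        h + Fintype.card (Summit.ValiantsHypothesis.ValiantsHypothesis.Theorems.BarrierLever.ChowMD.rowDefect v w') + 2 * h
          ≤ h * h) →
    (∀ π : Equiv.Perm (Fin h), h * h < h +
      Summit.ValiantsHypothesis.ValiantsHypothesis.Theorems.BarrierLever.ChowHybrid.colDefectMass v
        (fun j => (w' j).map π.toEmbedding) + 2 * h) →
    (∀ π : Equiv.Perm (Fin h), h * h < h +
      Summit.ValiantsHypothesis.ValiantsHypothesis.Theorems.BarrierLever.ChowHybrid.colDefectMass
        (fun j => (w' j).map π.toEmbedding) v + 2 * h) →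
    ∃ m : ℕ, m + 2 * h ≤ h * h ∧ ∃ ℓ : Fin m → MvPolynomial (Fin (h + h)) ℂ,
      (∀ k, (ℓ k).totalDegree ≤ 1) ∧
      (Matrix.of fun i j : Fin r => MvPolynomial.coeff
        (∑ a ∈ v i, Finsupp.single (Fin.castAdd h a) 1 +
          ∑ c ∈ w' j, Finsupp.single (Fin.natAdd h c) 1) (∏ k, ℓ k)).det ≠ 0

/-- **GLUE (unconditional, THEOREM H under relabelling): the relabelled large-defect node implies the large-defect node** — a
pair with a small relabelled defect mass on either side, for some `π`, is hit within budget by the relabelled hybrid design. -/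
theorem stub_thickLowerSetsChowRLargeDefect_of_relabel (hN : Stmt.stub_thickLowerSetsChowRLargeDefectRelabel) :
    Stmt.stub_thickLowerSetsChowRLargeDefect := by
  obtain ⟨h₀, hN⟩ := hN
  refine ⟨h₀, fun h hh r v w' hv hw hlv hlw hV hW hX hY hB hS hS' hMD _ _ => ?_⟩
  by_cases h1 : ∃ π : Equiv.Perm (Fin h), h + colDefectMass v (fun j => (w' j).map π.toEmbedding) + 2 * h ≤ h * h ∨
      h + colDefectMass (fun j => (w' j).map π.toEmbedding) v + 2 * h ≤ h * h
  · exact exists_chow_of_small_defect_relabel v w' hv hw hlv hlw h1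
  push Not at h1
  exact hN h hh r v w' hv hw hlv hlw hV hW hX hY hB hS hS' hMD (fun π => (h1 π).1) (fun π => (h1 π).2)

/-- **THE ITEM FROM THE RELABELLED LARGE-DEFECT NODE** (glue, then the large-defect composition of p733136). -/
theorem chowHitsPartitionMinorsR_of_thickLowerSetsLargeDefectRelabel
    (hN : Stmt.stub_thickLowerSetsChowRLargeDefectRelabel) :
    Summit.ValiantsHypothesis.ValiantsHypothesis.Theses.BarrierLever.ChowHitsPartitionMinorsR :=
  chowHitsPartitionMinorsR_of_thickLowerSetsLargeDefect (stub_thickLowerSetsChowRLargeDefect_of_relabel hN)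

end

end Summit.ValiantsHypothesis.ValiantsHypothesis.Theorems.BarrierLever.ChowNoStar
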